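import Literature.NumberTheory.LFunctions.VanDerCorputZeta
import Mathlib.Analysis.SpecialFunctions.Complex.LogBounds
import Mathlib.Analysis.SpecialFunctions.Log.Deriv
import Mathlib.Analysis.SpecialFunctions.Pow.Complex
import HarnessLib

/-!
# Vinogradov's shift `n ↦ n + xy` and the Taylor expansion of `log(1 + xy/n)` for the zeta sums

Topic `Literature/NumberTheory/LFunctions`.  Everything in this file is PROVED; no definitions, no named facts.

This is the first step of the proof of Theorem 6.2 of A. Ivić, *The Riemann Zeta-Function* (Wiley 1985),
§6.3, p. 121 (displays (6.36)–(6.40)), for the shifted zeta sums `S = ∑_{N < n ≤ R} (n + u)^{-it}`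
(`0 < u ≤ 1`, `N < R ≤ 2N`; the shift `u` is needed for Dirichlet `L`-functions and changes nothing):
for integers `a ≥ 1` with `2a² ≤ N` and `r ≥ 0`,

  `|S| ≤ a⁻² ∑_{N < n ≤ R} U(n) + 2 N t (a²/N)^{r+1} + 2a²`     (`norm_zetaSum_le_shift`),

where `U(n) = |∑_{x ≤ a} ∑_{y ≤ a} e(∑_{m=1}^{r} α_m(n) (xy)^m)|` with
`α_m(n) = (−1)^m t/(2π m (n+u)^m)`, the coefficients of `−(t/2π)` times the Taylor polynomial of
`log(1 + z)` at `z = xy/(n+u)`.  Ingredients: the shift `|∑_{N<n≤R} f(n) − ∑_{N<n≤R} f(n + d)| ≤ 2d` for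
`|f| ≤ 1` (`norm_sum_Ioc_sub_sum_Ioc_shift_le`); `(n + u + xy)^{-it} = (n+u)^{-it} e(−(t/2π) log(1 + xy/(n+u)))`;
`|log(1+z) − ∑_{m ≤ r} (−1)^{m-1} z^m/m| ≤ 2 z^{r+1}` for `0 ≤ z ≤ 1/2` (Mathlib's
`Real.abs_log_sub_add_sum_range_le`); and `|e(A) − e(B)| ≤ 2π|A − B|` (cf. `FordVK.norm_e_sub_e_le`).

## References
* A. Ivić, *The Riemann Zeta-Function*, John Wiley & Sons 1985 (Dover 2003), §6.3, proof of Theorem 6.2,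
  (6.36)–(6.40). [cite: Ivic1985, Theorem 6.2 (proof)]
-/

noncomputable section

open Finset Real Complex

namespace Literature.NumberTheory.LFunctions
namespace VinogradovZetaSum

open VdC (e)

/-! ### Elementary facts on `e` and the shifted powers -/

/-- `(x)^{-it} = e(−(t/2π) log x)` for real `x > 0`. [folklore] -/
theorem ofReal_cpow_neg_mul_I {x : ℝ} (hx : 0 < x) (t : ℝ) :
    (x : ℂ) ^ (-(t * I)) = e (-(t / (2 * π)) * Real.log x) := by
  rw [VdC.e, Complex.cpow_def_of_ne_zero (by exact_mod_cast hx.ne'), ← Complex.ofReal_log hx.le]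
  congr 1
  have hπ : (Real.pi : ℂ) ≠ 0 := by exact_mod_cast Real.pi_ne_zero
  push_cast
  field_simp

/-- The shifted term as a phase: `(n + u)^{-it} = e(−(t/2π) log(n + u))` (`n + u > 0`). [folklore] -/
theorem natCast_add_cpow_eq_e {u : ℝ} (hu : 0 < u) (t : ℝ) (n : ℕ) :
    ((n : ℂ) + u) ^ (-(t * I)) = e (-(t / (2 * π)) * Real.log (n + u)) := by
  have h : ((n : ℂ) + u) = (((n : ℝ) + u : ℝ) : ℂ) := by push_cast; ring
  rw [h, ofReal_cpow_neg_mul_I (by positivity)]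

/-! ### The shift `n ↦ n + d` -/

/-- **The shift**: for `|f| ≤ 1` and `d ≥ 0`, `|∑_{N<n≤R} f(n) − ∑_{N<n≤R} f(n+d)| ≤ 2d`. [cite: Ivic1985, Theorem 6.2 (proof)] -/
theorem norm_sum_Ioc_sub_sum_Ioc_shift_le {f : ℕ → ℂ} (hf : ∀ n, ‖f n‖ ≤ 1) (N R d : ℕ) :
    ‖∑ n ∈ Finset.Ioc N R, f n - ∑ n ∈ Finset.Ioc N R, f (n + d)‖ ≤ 2 * d := by
  classical
  have hshift : ∑ n ∈ Finset.Ioc N R, f (n + d) = ∑ n ∈ Finset.Ioc (N + d) (R + d), f n := by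
    rw [← Finset.image_add_right_Ioc, sum_image (fun x _ y _ h => by simpa using h)]
  rw [hshift, ← Finset.sum_sdiff_sub_sum_sdiff]
  have h1 : (Finset.Ioc N R \ Finset.Ioc (N + d) (R + d)) ⊆ Finset.Ioc N (N + d) := by
    intro n hn
    simp only [mem_sdiff, Finset.mem_Ioc, not_and, not_le] at hn ⊢
    constructor
    · exact hn.1.1
    · by_contra h; push Not at h; have := hn.2 (by omega); omega
  have h2 : (Finset.Ioc (N + d) (R + d) \ Finset.Ioc N R) ⊆ Finset.Ioc R (R + d) := by
    intro n hn
    simp only [mem_sdiff, Finset.mem_Ioc, not_and, not_le] at hn ⊢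
    constructor
    · by_contra h; push Not at h; have := hn.2 (by omega); omega
    · exact hn.1.2
  have hb : ∀ s : Finset ℕ, ‖∑ n ∈ s, f n‖ ≤ s.card := fun s =>
    (norm_sum_le _ _).trans (by
      calc ∑ n ∈ s, ‖f n‖ ≤ ∑ _n ∈ s, (1 : ℝ) := sum_le_sum fun n _ => hf n
        _ = s.card := by simp)
  calc ‖∑ n ∈ Finset.Ioc N R \ Finset.Ioc (N + d) (R + d), f n - ∑ n ∈ Finset.Ioc (N + d) (R + d) \ Finset.Ioc N R, f n‖
      ≤ ‖∑ n ∈ Finset.Ioc N R \ Finset.Ioc (N + d) (R + d), f n‖ + ‖∑ n ∈ Finset.Ioc (N + d) (R + d) \ Finset.Ioc N R, f n‖ :=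
        norm_sub_le _ _
    _ ≤ ((Finset.Ioc N R \ Finset.Ioc (N + d) (R + d)).card : ℝ) + ((Finset.Ioc (N + d) (R + d) \ Finset.Ioc N R).card : ℝ) :=
        add_le_add (hb _) (hb _)
    _ ≤ ((Finset.Ioc N (N + d)).card : ℝ) + ((Finset.Ioc R (R + d)).card : ℝ) :=
        add_le_add (by exact_mod_cast card_le_card h1) (by exact_mod_cast card_le_card h2)
    _ = 2 * d := by simp; ring

/-! ### Taylor expansion of the logarithm -/

/-- `|log(1 + z) − ∑_{i < r} (−1)^i z^{i+1}/(i+1)| ≤ 2 z^{r+1}` for `0 ≤ z ≤ 1/2`. [folklore] -/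
theorem abs_log_one_add_sub_taylor_le {z : ℝ} (hz0 : 0 ≤ z) (hz : z ≤ 1 / 2) (r : ℕ) :
    |Real.log (1 + z) - ∑ i ∈ range r, (-1) ^ i * z ^ (i + 1) / (i + 1)| ≤ 2 * z ^ (r + 1) := by
  have h := Real.abs_log_sub_add_sum_range_le (x := -z) (by rw [abs_neg, abs_of_nonneg hz0]; linarith) r
  have hsum : ∑ i ∈ range r, (-z) ^ (i + 1) / (i + 1) = -∑ i ∈ range r, (-1) ^ i * z ^ (i + 1) / (i + 1) := by
    rw [← sum_neg_distrib]
    refine sum_congr rfl fun i _ => ?_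
    rw [neg_pow, pow_succ (-1 : ℝ) i]; ring
  rw [hsum, sub_neg_eq_add, abs_neg, abs_of_nonneg hz0] at h
  rw [show Real.log (1 + z) - ∑ i ∈ range r, (-1) ^ i * z ^ (i + 1) / (i + 1) =
    -∑ i ∈ range r, (-1) ^ i * z ^ (i + 1) / (i + 1) + Real.log (1 + z) by ring]
  refine h.trans ?_
  rw [div_le_iff₀ (by linarith)]
  nlinarith [pow_nonneg hz0 (r + 1)]

/-- The Taylor polynomial written with the coefficients `α_m = (−1)^m t/(2π m w^m)`:
`−(t/2π) ∑_{i<r} (−1)^i (xy/w)^{i+1}/(i+1) = ∑_{j : Fin r} α_{j+1} (x^{j+1} y^{j+1})`. [folklore] -/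
theorem taylor_phase_eq (t w x y : ℝ) (hw : w ≠ 0) (r : ℕ) :
    -(t / (2 * π)) * ∑ i ∈ range r, (-1) ^ i * (x * y / w) ^ (i + 1) / (i + 1) =
      ∑ j : Fin r, ((-1) ^ (j.val + 1) * t / (2 * π * (j.val + 1) * w ^ (j.val + 1))) *
        (x ^ (j.val + 1) * y ^ (j.val + 1)) := by
  rw [mul_sum, ← Fin.sum_univ_eq_sum_range]
  refine sum_congr rfl fun j _ => ?_
  rw [div_pow, mul_pow, pow_succ ((-1 : ℝ)) j.val]
  field_simp

/-! ### The main inequality of this file -/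

set_option maxHeartbeats 800000 in
/-- **Vinogradov's shift for the zeta sums** (Ivić (6.36)–(6.40)): for `1 ≤ N < R ≤ 2N`, `t ≥ 0`, `u > 0`,
integers `a ≥ 1` with `2a² ≤ N` and any `r`,
`|∑_{N<n≤R} (n+u)^{-it}| ≤ a⁻² ∑_{N<n≤R} |∑_{x,y ≤ a} e(∑_{m ≤ r} α_m(n)(xy)^m)| + 2Nt(a²/N)^{r+1} + 2a²`,
`α_m(n) = (−1)^m t/(2π m (n+u)^m)`. [cite: Ivic1985, Theorem 6.2 (proof), (6.36)–(6.40)] -/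
theorem norm_zetaSum_le_shift {N R a : ℕ} (r : ℕ) {t u : ℝ} (hN : 1 ≤ N) (hNR : N < R) (hR2 : R ≤ 2 * N)
    (ht : 0 ≤ t) (hu0 : 0 < u) (ha : 1 ≤ a) (haN : 2 * a ^ 2 ≤ N) :
    ‖∑ n ∈ Finset.Ioc N R, ((n : ℂ) + u) ^ (-(t * I))‖ ≤
      1 / (a : ℝ) ^ 2 * ∑ n ∈ Finset.Ioc N R,
          ‖∑ x ∈ Finset.Icc (1 : ℤ) a, ∑ y ∈ Finset.Icc (1 : ℤ) a,
            e (∑ j : Fin r, ((-1) ^ (j.val + 1) * t / (2 * π * (j.val + 1) * ((n : ℝ) + u) ^ (j.val + 1))) *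
              ((x : ℝ) ^ (j.val + 1) * (y : ℝ) ^ (j.val + 1)))‖ +
        2 * N * t * ((a : ℝ) ^ 2 / N) ^ (r + 1) + 2 * (a : ℝ) ^ 2 := by
  classical
  -- `|e(A) − e(B)| ≤ 2π|A − B|` (as in `FordVK.norm_e_sub_e_le`)
  have norm_e_sub_e_le : ∀ A B : ℝ, ‖e A - e B‖ ≤ 2 * π * |A - B| := by
    intro A B
    have h1 : e A - e B = e B * (e (A - B) - 1) := by
      rw [mul_sub, mul_one, ← VdC.e_add]; congr 1; ring_nf
    rw [h1, norm_mul, VdC.norm_e, one_mul]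
    have h2 : e (A - B) = Complex.exp (Complex.I * ((2 * π * (A - B) : ℝ) : ℂ)) := by
      unfold VdC.e; rw [mul_comm]
    rw [h2]
    refine (Real.norm_exp_I_mul_ofReal_sub_one_le).trans (le_of_eq ?_)
    rw [Real.norm_eq_abs, abs_mul, abs_mul, abs_two, abs_of_pos Real.pi_pos]
  -- notation
  set f : ℕ → ℂ := fun n => ((n : ℂ) + u) ^ (-(t * I)) with hf
  set S := ∑ n ∈ Finset.Ioc N R, f n with hS
  set A : Finset ℕ := Finset.Icc 1 a with hA
  have ha0 : (0 : ℝ) < a := by exact_mod_cast ha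
  have hN0 : (0 : ℝ) < N := by exact_mod_cast hN
  have hAcard : (A.card : ℝ) = a := by rw [hA, Nat.card_Icc]; simp
  have hf1 : ∀ n, ‖f n‖ ≤ 1 := by
    intro n
    rw [hf]; dsimp only
    rw [natCast_add_cpow_eq_e hu0, VdC.norm_e]
  -- the coefficient function and the double sum `U n`, over `ℤ`-indices as in the statement
  let α : ℕ → Fin r → ℝ := fun n j => (-1) ^ (j.val + 1) * t / (2 * π * (j.val + 1) * ((n : ℝ) + u) ^ (j.val + 1))
  let Uz : ℕ → ℝ := fun n => ‖∑ x ∈ Finset.Icc (1 : ℤ) a, ∑ y ∈ Finset.Icc (1 : ℤ) a,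
    e (∑ j : Fin r, α n j * ((x : ℝ) ^ (j.val + 1) * (y : ℝ) ^ (j.val + 1)))‖
  -- the same double sum over `ℕ`-indices
  let T : ℕ → ℂ := fun n => ∑ x ∈ A, ∑ y ∈ A, e (∑ j : Fin r, α n j * ((x : ℝ) ^ (j.val + 1) * (y : ℝ) ^ (j.val + 1)))
  have hTU : ∀ n, ‖T n‖ = Uz n := by
    intro n
    simp only [T, Uz]
    congr 1
    -- reindex `ℕ → ℤ`
    have hcast : ∀ g : ℤ → ℂ, ∑ x ∈ A, g (x : ℤ) = ∑ x ∈ Finset.Icc (1 : ℤ) a, g x := by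
      intro g
      refine Finset.sum_nbij' (fun x : ℕ => (x : ℤ)) (fun x : ℤ => x.toNat) ?_ ?_ ?_ ?_ ?_
      · intro x hx; rw [hA, Finset.mem_Icc] at hx; rw [Finset.mem_Icc]; omega
      · intro x hx; rw [Finset.mem_Icc] at hx; rw [hA, Finset.mem_Icc]; omega
      · intro x _; simp
      · intro x hx; rw [Finset.mem_Icc] at hx; omega
      · intro x _; rfl
    rw [← hcast]
    refine sum_congr rfl fun x _ => ?_
    rw [← hcast]
    refine sum_congr rfl fun y _ => ?_
    push_cast; rfl
  -- Step 1: the shift, for each pair `(x, y)`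
  have hpair : ∀ x ∈ A, ∀ y ∈ A, ‖S - ∑ n ∈ Finset.Ioc N R, f (n + x * y)‖ ≤ 2 * (a : ℝ) ^ 2 := by
    intro x hx y hy
    rw [hA, Finset.mem_Icc] at hx hy
    refine (norm_sum_Ioc_sub_sum_Ioc_shift_le hf1 N R (x * y)).trans ?_
    have : ((x * y : ℕ) : ℝ) ≤ (a : ℝ) ^ 2 := by
      have h : x * y ≤ a * a := Nat.mul_le_mul hx.2 hy.2
      calc ((x * y : ℕ) : ℝ) ≤ ((a * a : ℕ) : ℝ) := by exact_mod_cast h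
        _ = (a : ℝ) ^ 2 := by push_cast; ring
    linarith
  -- Step 2: factorisation `f(n + xy) = f̃(n) e(−(t/2π) log(1 + xy/(n+u)))` and Taylor
  have hterm : ∀ n ∈ Finset.Ioc N R, ∀ x ∈ A, ∀ y ∈ A,
      ‖f (n + x * y) - e (-(t / (2 * π)) * Real.log ((n : ℝ) + u)) *
          e (∑ j : Fin r, α n j * ((x : ℝ) ^ (j.val + 1) * (y : ℝ) ^ (j.val + 1)))‖ ≤
        2 * t * ((a : ℝ) ^ 2 / N) ^ (r + 1) := by
    intro n hn x hx y hy
    rw [Finset.mem_Ioc] at hn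
    rw [hA, Finset.mem_Icc] at hx hy
    set w : ℝ := (n : ℝ) + u with hw
    have hw0 : 0 < w := by positivity
    have hwN : (N : ℝ) ≤ w := by
      have : (N : ℝ) ≤ n := by exact_mod_cast hn.1.le
      rw [hw]; linarith
    set z : ℝ := (x : ℝ) * y / w with hz
    have hxy0 : (0 : ℝ) ≤ (x : ℝ) * y := by positivity
    have hxya : (x : ℝ) * y ≤ (a : ℝ) ^ 2 := by
      have h : x * y ≤ a * a := Nat.mul_le_mul hx.2 hy.2
      calc (x : ℝ) * y = ((x * y : ℕ) : ℝ) := by push_cast; ring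
        _ ≤ ((a * a : ℕ) : ℝ) := by exact_mod_cast h
        _ = (a : ℝ) ^ 2 := by push_cast; ring
    have hz0 : 0 ≤ z := by positivity
    have hzle : z ≤ (a : ℝ) ^ 2 / N := by
      rw [hz]
      calc (x : ℝ) * y / w ≤ (a : ℝ) ^ 2 / w := by gcongr
        _ ≤ (a : ℝ) ^ 2 / N := by gcongr
    have ha2N : (a : ℝ) ^ 2 / N ≤ 1 / 2 := by
      rw [div_le_iff₀ hN0]
      have : ((2 * a ^ 2 : ℕ) : ℝ) ≤ N := by exact_mod_cast haN
      push_cast at this; linarith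
    have hzh : z ≤ 1 / 2 := hzle.trans ha2N
    -- `f(n + xy) = e(−(t/2π) log w) e(−(t/2π) log(1+z))`
    have hfac : f (n + x * y) = e (-(t / (2 * π)) * Real.log w) * e (-(t / (2 * π)) * Real.log (1 + z)) := by
      rw [hf]; dsimp only
      rw [← VdC.e_add, ← mul_add, ← Real.log_mul hw0.ne' (by positivity)]
      have h1 : w * (1 + z) = ((n + x * y : ℕ) : ℝ) + u := by
        rw [hz]; field_simp; push_cast; rw [hw]; ring
      rw [h1, natCast_add_cpow_eq_e hu0]
    rw [hfac, ← mul_sub, norm_mul, VdC.norm_e, one_mul]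
    -- Taylor
    have hphase : ∑ j : Fin r, α n j * ((x : ℝ) ^ (j.val + 1) * (y : ℝ) ^ (j.val + 1)) =
        -(t / (2 * π)) * ∑ i ∈ range r, (-1) ^ i * ((x : ℝ) * y / w) ^ (i + 1) / (i + 1) := by
      rw [taylor_phase_eq t w x y hw0.ne' r]
    rw [hphase]
    refine (norm_e_sub_e_le _ _).trans ?_
    rw [← mul_sub, abs_mul, abs_neg, abs_div, abs_of_nonneg ht, abs_of_pos (by positivity : (0 : ℝ) < 2 * π)]
    have htaylor := abs_log_one_add_sub_taylor_le hz0 hzh r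
    rw [← hz]
    have hzpow : z ^ (r + 1) ≤ ((a : ℝ) ^ 2 / N) ^ (r + 1) := pow_le_pow_left₀ hz0 hzle _
    calc 2 * π * (t / (2 * π) * |Real.log (1 + z) - ∑ i ∈ range r, (-1) ^ i * z ^ (i + 1) / (i + 1)|)
        = t * |Real.log (1 + z) - ∑ i ∈ range r, (-1) ^ i * z ^ (i + 1) / (i + 1)| := by
          field_simp
      _ ≤ t * (2 * z ^ (r + 1)) := by gcongr
      _ ≤ t * (2 * ((a : ℝ) ^ 2 / N) ^ (r + 1)) := by gcongr
      _ = 2 * t * ((a : ℝ) ^ 2 / N) ^ (r + 1) := by ring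
  -- Step 3: summing over `n`: `‖∑_n f(n + xy) summed over (x,y)‖ ≤ ∑_n ‖T n‖ + (R-N) a² · 2t(a²/N)^{r+1}`
  have hsum_xy : ‖∑ x ∈ A, ∑ y ∈ A, ∑ n ∈ Finset.Ioc N R, f (n + x * y)‖ ≤
      ∑ n ∈ Finset.Ioc N R, Uz n + N * (a : ℝ) ^ 2 * (2 * t * ((a : ℝ) ^ 2 / N) ^ (r + 1)) := by
    -- swap sums
    have hswap : ∑ x ∈ A, ∑ y ∈ A, ∑ n ∈ Finset.Ioc N R, f (n + x * y) =
        ∑ n ∈ Finset.Ioc N R, ∑ x ∈ A, ∑ y ∈ A, f (n + x * y) := by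
      calc ∑ x ∈ A, ∑ y ∈ A, ∑ n ∈ Finset.Ioc N R, f (n + x * y)
          = ∑ x ∈ A, ∑ n ∈ Finset.Ioc N R, ∑ y ∈ A, f (n + x * y) := sum_congr rfl fun x _ => sum_comm
        _ = ∑ n ∈ Finset.Ioc N R, ∑ x ∈ A, ∑ y ∈ A, f (n + x * y) := sum_comm
    rw [hswap]
    refine (norm_sum_le _ _).trans ?_
    have hcardIoc : ((Finset.Ioc N R).card : ℝ) ≤ N := by
      rw [Nat.card_Ioc]
      have : R - N ≤ N := by omega
      exact_mod_cast this
    have hn_each : ∀ n ∈ Finset.Ioc N R, ‖∑ x ∈ A, ∑ y ∈ A, f (n + x * y)‖ ≤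
        Uz n + (a : ℝ) ^ 2 * (2 * t * ((a : ℝ) ^ 2 / N) ^ (r + 1)) := by
      intro n hn
      -- compare with `f̃(n) T(n)`
      have hdiff : ‖∑ x ∈ A, ∑ y ∈ A, f (n + x * y) - e (-(t / (2 * π)) * Real.log ((n : ℝ) + u)) * T n‖ ≤
          (a : ℝ) ^ 2 * (2 * t * ((a : ℝ) ^ 2 / N) ^ (r + 1)) := by
        simp only [T]
        rw [mul_sum, ← sum_sub_distrib]
        refine (norm_sum_le _ _).trans ?_
        calc ∑ x ∈ A, ‖∑ y ∈ A, f (n + x * y) - e (-(t / (2 * π)) * Real.log ((n : ℝ) + u)) *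
              ∑ y ∈ A, e (∑ j : Fin r, α n j * ((x : ℝ) ^ (j.val + 1) * (y : ℝ) ^ (j.val + 1)))‖
            ≤ ∑ x ∈ A, ∑ y ∈ A, (2 * t * ((a : ℝ) ^ 2 / N) ^ (r + 1)) := by
              refine sum_le_sum fun x hx => ?_
              rw [mul_sum, ← sum_sub_distrib]
              refine (norm_sum_le _ _).trans (sum_le_sum fun y hy => hterm n hn x hx y hy)
          _ = (a : ℝ) ^ 2 * (2 * t * ((a : ℝ) ^ 2 / N) ^ (r + 1)) := by
              rw [sum_const, sum_const, nsmul_eq_mul, nsmul_eq_mul, hAcard]; ring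
      have hmain : ‖e (-(t / (2 * π)) * Real.log ((n : ℝ) + u)) * T n‖ = Uz n := by
        rw [norm_mul, VdC.norm_e, one_mul, hTU]
      calc ‖∑ x ∈ A, ∑ y ∈ A, f (n + x * y)‖
          ≤ ‖e (-(t / (2 * π)) * Real.log ((n : ℝ) + u)) * T n‖ +
              ‖∑ x ∈ A, ∑ y ∈ A, f (n + x * y) - e (-(t / (2 * π)) * Real.log ((n : ℝ) + u)) * T n‖ :=
            norm_le_norm_add_norm_sub' _ _
        _ ≤ Uz n + (a : ℝ) ^ 2 * (2 * t * ((a : ℝ) ^ 2 / N) ^ (r + 1)) := by rw [hmain]; gcongr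
    calc ∑ n ∈ Finset.Ioc N R, ‖∑ x ∈ A, ∑ y ∈ A, f (n + x * y)‖
        ≤ ∑ n ∈ Finset.Ioc N R, (Uz n + (a : ℝ) ^ 2 * (2 * t * ((a : ℝ) ^ 2 / N) ^ (r + 1))) := sum_le_sum hn_each
      _ = ∑ n ∈ Finset.Ioc N R, Uz n + (Finset.Ioc N R).card * ((a : ℝ) ^ 2 * (2 * t * ((a : ℝ) ^ 2 / N) ^ (r + 1))) := by
          rw [sum_add_distrib, sum_const, nsmul_eq_mul]
      _ ≤ ∑ n ∈ Finset.Ioc N R, Uz n + N * ((a : ℝ) ^ 2 * (2 * t * ((a : ℝ) ^ 2 / N) ^ (r + 1))) := by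
          gcongr
      _ = _ := by ring
  -- Step 4: `a² S = ∑_{x,y} S`, compare with `∑_{x,y} ∑_n f(n+xy)`
  have hAcardN : A.card = a := by rw [hA, Nat.card_Icc]; omega
  have hS_avg : (a : ℂ) ^ 2 * S = ∑ x ∈ A, ∑ y ∈ A, S := by
    rw [sum_const, sum_const, smul_smul, nsmul_eq_mul, hAcardN]
    push_cast; ring
  have hdiff : ‖(a : ℂ) ^ 2 * S - ∑ x ∈ A, ∑ y ∈ A, ∑ n ∈ Finset.Ioc N R, f (n + x * y)‖ ≤ 2 * (a : ℝ) ^ 4 := by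
    rw [hS_avg, ← sum_sub_distrib]
    refine (norm_sum_le _ _).trans ?_
    calc ∑ x ∈ A, ‖∑ y ∈ A, S - ∑ y ∈ A, ∑ n ∈ Finset.Ioc N R, f (n + x * y)‖
        ≤ ∑ x ∈ A, ∑ y ∈ A, 2 * (a : ℝ) ^ 2 := by
          refine sum_le_sum fun x hx => ?_
          rw [← sum_sub_distrib]
          exact (norm_sum_le _ _).trans (sum_le_sum fun y hy => hpair x hx y hy)
      _ = 2 * (a : ℝ) ^ 4 := by rw [sum_const, sum_const, nsmul_eq_mul, nsmul_eq_mul, hAcard]; ring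
  -- conclusion
  have hkey : (a : ℝ) ^ 2 * ‖S‖ ≤ ∑ n ∈ Finset.Ioc N R, Uz n +
      N * (a : ℝ) ^ 2 * (2 * t * ((a : ℝ) ^ 2 / N) ^ (r + 1)) + 2 * (a : ℝ) ^ 4 := by
    have h1 : (a : ℝ) ^ 2 * ‖S‖ = ‖(a : ℂ) ^ 2 * S‖ := by
      rw [norm_mul, norm_pow, Complex.norm_natCast]
    rw [h1]
    calc ‖(a : ℂ) ^ 2 * S‖ ≤ ‖∑ x ∈ A, ∑ y ∈ A, ∑ n ∈ Finset.Ioc N R, f (n + x * y)‖ +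
          ‖(a : ℂ) ^ 2 * S - ∑ x ∈ A, ∑ y ∈ A, ∑ n ∈ Finset.Ioc N R, f (n + x * y)‖ :=
          norm_le_norm_add_norm_sub' _ _
      _ ≤ _ := by linarith [hsum_xy, hdiff]
  have ha2 : (0 : ℝ) < (a : ℝ) ^ 2 := by positivity
  rw [show ‖S‖ = 1 / (a : ℝ) ^ 2 * ((a : ℝ) ^ 2 * ‖S‖) by field_simp]
  calc 1 / (a : ℝ) ^ 2 * ((a : ℝ) ^ 2 * ‖S‖)
      ≤ 1 / (a : ℝ) ^ 2 * (∑ n ∈ Finset.Ioc N R, Uz n + N * (a : ℝ) ^ 2 * (2 * t * ((a : ℝ) ^ 2 / N) ^ (r + 1)) +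
          2 * (a : ℝ) ^ 4) := by gcongr
    _ = 1 / (a : ℝ) ^ 2 * ∑ n ∈ Finset.Ioc N R, Uz n + 2 * N * t * ((a : ℝ) ^ 2 / N) ^ (r + 1) + 2 * (a : ℝ) ^ 2 := by
        field_simp

end VinogradovZetaSum
end Literature.NumberTheory.LFunctions
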